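import Literature.NumberTheory.Rogawski1990.ArchDeltaTransferCentralVanishing          -- ★ (S-c) `archDeltaTransfer_apply_center_eq_zero` and its whole import cone ((β), (3A′), frames, congruences)
import Literature.NumberTheory.Rogawski1990.ArchEndoscopicTorusTransferIdentityPre       -- ★ (β₀) `exists_sum_integral_pi_eq_inv_mul_finsum_delta` (ONE κ, every regular torus datum)
import Literature.NumberTheory.Rogawski1990.ArchDeltaClassSumCongruence                  -- ★ (α) `finsum_delta_mul_integral_comp_conj_eq_comap`
import Literature.NumberTheory.Automorphic.ArchEndoscopicCentralDescentValue              -- ★ V1 p854794 `sum_integral_pi_empty_eq_card_smul_apply_center`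
import Literature.NumberTheory.Rogawski1990.ArchSplitRationalWallTorusPoint              -- ★ (m2) `exists_isStablyConj_cmRationalToArch_archDiagTorus_wall`
import Literature.NumberTheory.Rogawski1990.ArchSingularStableClassFrames                -- ★ `exists_isSingularArchFrame_of_isStablyConj_cmRationalToArch` (all classes framed)
import Literature.NumberTheory.Rogawski1990.TamagawaSingularKappaBlockTransport          -- ★ `not_isRegularElt_of_charpoly_eq_sq_mul`
import Literature.NumberTheory.Weil1964.UnitaryArchSingularTopFormFamily                 -- ★ `archSingularTopFormFamily`
import Literature.NumberTheory.Rogawski1990.ArchCanonicalTransferFactor                  -- ★ `archCanonicalTransferFactor_Δ`, `archGlobalSign_cast_ne_zero`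
import Literature.NumberTheory.Rogawski1990.ArchCanonicalSingularHaar                   -- ★ `isHaarMeasure_of_archCanonicalSingularMatrix`, `ArchCanonicalSingularMatrix`
import Summits.HodgeConjecture.HodgeConjecture.Theorems.K2E4ExplicitArchSingularTransferDefs    -- ★ (this seat) `HStepData`, `GPrimeData` (the two analytic inputs, as data)
import Summits.HodgeConjecture.HodgeConjecture.Theorems.K2E4ExplicitArchSingularTransferEngine  -- ★ (this seat) `joint_induction`, the speed-0 adapter, `νHi` Haar, curve regularity
import HarnessLib

/-!
# `K2E4ExplicitArchSingularTransferOfPackages` — THE ASSEMBLY of socket #9 `sig_K2E4ExplicitArchSingularTransfer` (Prop. 8.2.1 (a) at `∞`)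
# from the H-STEP LAW (K2E4-p13 «V1+»), the G′-PACKAGE (K2E4-p11) and the top-form TRANSPORT, over the joint place-induction engine (K2E4-p11 p854825)

Track B ∕ K2-LIT, crux h413 = `stmt-HodgeConjecture-24833`, route of record `HCCMUnconditional`; prover seat `hodgecm-mathlib-K2E4-p09` (g0), ASSEMBLER of the XL core per
chair ruling R-13a (K2-lead 2026-09-03T21:12:38Z).  THEOREMS ONLY (no `def`, no `instance`, no notation, no `sorry`); lane `--supports stmt-HodgeConjecture-24833 --as helper`.
The three inputs are HYPOTHESES: `hH : ∀ νw z w₁, HStepData L νw z w₁`, `hG : ∀ frame, GPrimeData L α T′ ν e₁ e₂ h₁ h₂` (★ `K2E4ExplicitArchSingularTransferDefs`), `hTr` (the transport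
of the unsigned top-form stable sum along a rational congruence; this seat's next file).  The frame is the part of socket #9's frame the proof READS (`hACS`, `hherm`, the explicit
ray `hTinf`, `μ`); the conclusion is socket #9's tail VERBATIM, so the by-name file is `intro …; exact explicitArchSingularTransfer_of_packages … hH hG hTr …`.

THE PROOF (Rogawski p. 119 «we apply the limit formulas for H and H′», place by place as in ★ `archDeltaTransfer_apply_center_eq_zero` but WITH VALUES):
1. FRAME: rational diagonal frame `Φ : U(diagonal α′)_∞ ≃ₜ* U(H′)_∞` (★ `exists_formCongr_eq_diagonal`); the ray `Tinf.Δ = c(H′)·Δ″_∞` (★ `archCanonicalTransferFactor_Δ`) is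
   congruence-covariant; `νGi`, `νHi` are Haar (admissible Weil quotients are non-zero); the wall torus point `t(e₁,e₂,e₁) ∼_st Φ⁻¹(γ₀ ⊗ 1)` (★ (m2)).
2. THE 2-BLOCK: `Ψ = Φ_{Q₂}`, Haar `ν_w`, the test function `Θ₂` of `aH` with `U(Φ₁)`-coordinate frozen at `e₂ ⊗ 1` (★ `ArchSmooth₂.exists_contDiff_twoBlock`); the centre
   `(e₁•1₂) ⊗ 1` is the constant torus point `(σ_w e₁, σ_w e₁)_w`.
3. JOINT INDUCTION (`joint_induction`, data `u : W → Fin 2 → S¹`, regularity «`u_w,0 ≠ u_w,1`, `u_w,i ≠ σ_w e₂`», curve `(σe₁ e^{iψ}, σe₁ e^{−iψ})`, observable `2 sin ψ • x`, filter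
   `𝓝[>] 0`): H-state `A(S,u) = κ ∏_{w∈S} C_w · Σ_ε ∫ Θ₂ d⊗M(univ ∖ S, u, ε)` (step law from `hH`), G′-state from `hG`; they agree at `S = ∅` by ★ (β₀) + ★ (α) at every regular datum
   (the speed-0 adapter), hence at `S = univ`: `κ ∏_w C_w · 2^{|W|} · aH(γ_H ⊗ 1) = λ · Φ^{st}_∞(t(e₁,e₂,e₁), a ∘ Φ)` (★ `sum_integral_pi_empty_eq_card_smul_apply_center`).
4. TRANSPORT (`hTr`) ⇒ `cinf = κ ∏_w C_w 2^{|W|} ∕ λ ≠ 0`.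
HONEST LABEL: HC_CM is proved only modulo the 7 printed citations (2 remaining named inputs: hLiu418 = `stmt-HodgeConjecture-24832`, h413 = `stmt-HodgeConjecture-24833`) until rung 0
closes; this file moves no counter — it closes socket #9 MODULO the three named inputs.

References: [Rogawski1990] Ann. of Math. Stud. 123 (1990), §8.2 Prop. 8.2.1 (a) pp. 118–119, §4.3 (4.3.1) p. 43, §14.5 Lemma 14.5.2 (b) pp. 238–239; [Varadarajan1989] §6.4 Thm. 22.
-/

set_option autoImplicit false
set_option linter.dupNamespace false  -- the mandated namespace repeats the single-problem summit's segment

noncomputable section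

open MeasureTheory Measure NumberField NumberField.InfinitePlace NumberField.mixedEmbedding IsDedekindDomain Filter Topology Set
open Literature.MeasureTheory.Group Literature.NumberTheory.Rogawski1990 Literature.NumberTheory.Automorphic Literature.NumberTheory.GaloisRepresentations
open Literature.AlgebraicGeometry.ShimuraVarieties (unitaryGroup hermForm)
open Summit.HodgeConjecture.HodgeConjecture.Cruxes.H413.K2E4ExplicitArchSingularTransferDefs
open Summit.HodgeConjecture.HodgeConjecture.Cruxes.H413.K2E4ExplicitArchSingularTransferEngine
open scoped Matrix MatrixGroups ComplexOrder ContDiff Classical Matrix.Norms.Operator  -- `Classical`: the place subtypes of `mixedSpace L` are `Fintype` classically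

namespace Summit.HodgeConjecture.HodgeConjecture.Cruxes.H413.K2E4ExplicitArchSingularTransferOfPackages

section Frame

variable (L : Type) [Field L] [NumberField L] [IsCMField L] (H' : Matrix (Fin 3) (Fin 3) L) (Tinf : ArchTransferFactor L H')
    [MeasurableSpace (UnitaryGroup.arch (↥(maximalRealSubfield L)) L (IsCMField.complexConj L) 3 H')] [BorelSpace (UnitaryGroup.arch (↥(maximalRealSubfield L)) L (IsCMField.complexConj L) 3 H')]
    [∀ γ : UnitaryGroup.arch (↥(maximalRealSubfield L)) L (IsCMField.complexConj L) 3 H', MeasurableSpace (UnitaryGroup.arch (↥(maximalRealSubfield L)) L (IsCMField.complexConj L) 3 H' ⧸ Subgroup.centralizer ({γ} : Set (UnitaryGroup.arch (↥(maximalRealSubfield L)) L (IsCMField.complexConj L) 3 H')))]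
    [∀ γ : UnitaryGroup.arch (↥(maximalRealSubfield L)) L (IsCMField.complexConj L) 3 H', BorelSpace (UnitaryGroup.arch (↥(maximalRealSubfield L)) L (IsCMField.complexConj L) 3 H' ⧸ Subgroup.centralizer ({γ} : Set (UnitaryGroup.arch (↥(maximalRealSubfield L)) L (IsCMField.complexConj L) 3 H')))]
    [MeasurableSpace (UnitaryGroup.arch (↥(maximalRealSubfield L)) L (IsCMField.complexConj L) 3 (Matrix.of fun i j : Fin 3 => if i.val + j.val + 1 = 3 then (1 : L) else 0))] [BorelSpace (UnitaryGroup.arch (↥(maximalRealSubfield L)) L (IsCMField.complexConj L) 3 (Matrix.of fun i j : Fin 3 => if i.val + j.val + 1 = 3 then (1 : L) else 0))]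
    [∀ γ : UnitaryGroup.arch (↥(maximalRealSubfield L)) L (IsCMField.complexConj L) 3 (Matrix.of fun i j : Fin 3 => if i.val + j.val + 1 = 3 then (1 : L) else 0),
      MeasurableSpace (UnitaryGroup.arch (↥(maximalRealSubfield L)) L (IsCMField.complexConj L) 3 (Matrix.of fun i j : Fin 3 => if i.val + j.val + 1 = 3 then (1 : L) else 0) ⧸ Subgroup.centralizer ({γ} : Set (UnitaryGroup.arch (↥(maximalRealSubfield L)) L (IsCMField.complexConj L) 3 (Matrix.of fun i j : Fin 3 => if i.val + j.val + 1 = 3 then (1 : L) else 0))))]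
    [∀ γ : UnitaryGroup.arch (↥(maximalRealSubfield L)) L (IsCMField.complexConj L) 3 (Matrix.of fun i j : Fin 3 => if i.val + j.val + 1 = 3 then (1 : L) else 0),
      BorelSpace (UnitaryGroup.arch (↥(maximalRealSubfield L)) L (IsCMField.complexConj L) 3 (Matrix.of fun i j : Fin 3 => if i.val + j.val + 1 = 3 then (1 : L) else 0) ⧸ Subgroup.centralizer ({γ} : Set (UnitaryGroup.arch (↥(maximalRealSubfield L)) L (IsCMField.complexConj L) 3 (Matrix.of fun i j : Fin 3 => if i.val + j.val + 1 = 3 then (1 : L) else 0))))]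
    [MeasurableSpace (UnitaryGroup.arch (↥(maximalRealSubfield L)) L (IsCMField.complexConj L) 2 (Matrix.of fun i j : Fin 2 => if i.val + j.val + 1 = 2 then (1 : L) else 0) ×
          UnitaryGroup.arch (↥(maximalRealSubfield L)) L (IsCMField.complexConj L) 1 (Matrix.of fun i j : Fin 1 => if i.val + j.val + 1 = 1 then (1 : L) else 0))]
    [BorelSpace (UnitaryGroup.arch (↥(maximalRealSubfield L)) L (IsCMField.complexConj L) 2 (Matrix.of fun i j : Fin 2 => if i.val + j.val + 1 = 2 then (1 : L) else 0) ×
          UnitaryGroup.arch (↥(maximalRealSubfield L)) L (IsCMField.complexConj L) 1 (Matrix.of fun i j : Fin 1 => if i.val + j.val + 1 = 1 then (1 : L) else 0))]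
    [∀ a : (UnitaryGroup.arch (↥(maximalRealSubfield L)) L (IsCMField.complexConj L) 2 (Matrix.of fun i j : Fin 2 => if i.val + j.val + 1 = 2 then (1 : L) else 0) ×
          UnitaryGroup.arch (↥(maximalRealSubfield L)) L (IsCMField.complexConj L) 1 (Matrix.of fun i j : Fin 1 => if i.val + j.val + 1 = 1 then (1 : L) else 0)),
      MeasurableSpace ((UnitaryGroup.arch (↥(maximalRealSubfield L)) L (IsCMField.complexConj L) 2 (Matrix.of fun i j : Fin 2 => if i.val + j.val + 1 = 2 then (1 : L) else 0) ×
          UnitaryGroup.arch (↥(maximalRealSubfield L)) L (IsCMField.complexConj L) 1 (Matrix.of fun i j : Fin 1 => if i.val + j.val + 1 = 1 then (1 : L) else 0)) ⧸ Subgroup.centralizer ({a} : Set (UnitaryGroup.arch (↥(maximalRealSubfield L)) L (IsCMField.complexConj L) 2 (Matrix.of fun i j : Fin 2 => if i.val + j.val + 1 = 2 then (1 : L) else 0) ×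
          UnitaryGroup.arch (↥(maximalRealSubfield L)) L (IsCMField.complexConj L) 1 (Matrix.of fun i j : Fin 1 => if i.val + j.val + 1 = 1 then (1 : L) else 0))))]
    [∀ a : (UnitaryGroup.arch (↥(maximalRealSubfield L)) L (IsCMField.complexConj L) 2 (Matrix.of fun i j : Fin 2 => if i.val + j.val + 1 = 2 then (1 : L) else 0) ×
          UnitaryGroup.arch (↥(maximalRealSubfield L)) L (IsCMField.complexConj L) 1 (Matrix.of fun i j : Fin 1 => if i.val + j.val + 1 = 1 then (1 : L) else 0)),
      BorelSpace ((UnitaryGroup.arch (↥(maximalRealSubfield L)) L (IsCMField.complexConj L) 2 (Matrix.of fun i j : Fin 2 => if i.val + j.val + 1 = 2 then (1 : L) else 0) ×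
          UnitaryGroup.arch (↥(maximalRealSubfield L)) L (IsCMField.complexConj L) 1 (Matrix.of fun i j : Fin 1 => if i.val + j.val + 1 = 1 then (1 : L) else 0)) ⧸ Subgroup.centralizer ({a} : Set (UnitaryGroup.arch (↥(maximalRealSubfield L)) L (IsCMField.complexConj L) 2 (Matrix.of fun i j : Fin 2 => if i.val + j.val + 1 = 2 then (1 : L) else 0) ×
          UnitaryGroup.arch (↥(maximalRealSubfield L)) L (IsCMField.complexConj L) 1 (Matrix.of fun i j : Fin 1 => if i.val + j.val + 1 = 1 then (1 : L) else 0))))]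
    (νGi : Measure (UnitaryGroup.arch (↥(maximalRealSubfield L)) L (IsCMField.complexConj L) 3 H')) (νqi : Measure (UnitaryGroup.arch (↥(maximalRealSubfield L)) L (IsCMField.complexConj L) 3 (Matrix.of fun i j : Fin 3 => if i.val + j.val + 1 = 3 then (1 : L) else 0)))
    (νHi : Measure (UnitaryGroup.arch (↥(maximalRealSubfield L)) L (IsCMField.complexConj L) 2 (Matrix.of fun i j : Fin 2 => if i.val + j.val + 1 = 2 then (1 : L) else 0) ×
          UnitaryGroup.arch (↥(maximalRealSubfield L)) L (IsCMField.complexConj L) 1 (Matrix.of fun i j : Fin 1 => if i.val + j.val + 1 = 1 then (1 : L) else 0)))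
    [IsFiniteMeasureOnCompacts νGi] [νGi.IsMulRightInvariant] [IsFiniteMeasureOnCompacts νqi] [νqi.IsMulRightInvariant]
    [IsFiniteMeasureOnCompacts νHi] [νHi.IsMulRightInvariant]

set_option maxHeartbeats 16000000 in
set_option synthInstance.maxHeartbeats 800000 in
/-- **SOCKET #9 FROM THE THREE INPUTS.**  `hH` = the H-STEP LAW as data at every place (K2E4-p13 «V1+»); `hG` = the G′-PACKAGE as data on every rational diagonal frame (K2E4-p11);
`hTr` = the transport of the unsigned top-form stable sum along a rational congruence `Φ` and a stable conjugacy `Φ⁻¹ x ∼_st y` when the whole stable class of `x` is framed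
(K2E4-p09, next file).  Frame: the part of socket #9's frame the proof reads; conclusion: socket #9's tail VERBATIM (`cinf = κ · ∏_w C_w · 2^{|W|} ∕ λ`).
[cite: Rogawski1990, §8.2 Prop. 8.2.1 (a) p. 118, proof pp. 118–119; §14.5 Lemma 14.5.2 (b) pp. 238–239] [cite: Varadarajan1989, §6.4 Thm. 22] -/
theorem explicitArchSingularTransfer_of_packages
    (hH : ∀ [∀ w : {w : InfinitePlace L // IsComplex w}, MeasurableSpace (UnitaryGroup.archLocal L 2 (Matrix.diagonal ![(2 : L)⁻¹, -(2 : L)⁻¹]) w)] [∀ w : {w : InfinitePlace L // IsComplex w}, BorelSpace (UnitaryGroup.archLocal L 2 (Matrix.diagonal ![(2 : L)⁻¹, -(2 : L)⁻¹]) w)]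
        (νw : ∀ w : {w : InfinitePlace L // IsComplex w}, Measure (UnitaryGroup.archLocal L 2 (Matrix.diagonal ![(2 : L)⁻¹, -(2 : L)⁻¹]) w)) [∀ w, (νw w).IsHaarMeasure] (z : {w : InfinitePlace L // IsComplex w} → Circle) (w₁ : {w : InfinitePlace L // IsComplex w}), HStepData L νw z w₁)
    (hG : ∀ (α : Fin 3 → L) (_hα : ∀ i, α i ≠ 0) (_hαh : ∀ i, (IsCMField.complexConj L (α i) : L) = α i)
        [MeasurableSpace (UnitaryGroup.arch (↥(maximalRealSubfield L)) L (IsCMField.complexConj L) 3 (Matrix.diagonal α))] [BorelSpace (UnitaryGroup.arch (↥(maximalRealSubfield L)) L (IsCMField.complexConj L) 3 (Matrix.diagonal α))]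
        [∀ γ : UnitaryGroup.arch (↥(maximalRealSubfield L)) L (IsCMField.complexConj L) 3 (Matrix.diagonal α), MeasurableSpace (UnitaryGroup.arch (↥(maximalRealSubfield L)) L (IsCMField.complexConj L) 3 (Matrix.diagonal α) ⧸ Subgroup.centralizer ({γ} : Set (UnitaryGroup.arch (↥(maximalRealSubfield L)) L (IsCMField.complexConj L) 3 (Matrix.diagonal α))))]
        [∀ γ : UnitaryGroup.arch (↥(maximalRealSubfield L)) L (IsCMField.complexConj L) 3 (Matrix.diagonal α), BorelSpace (UnitaryGroup.arch (↥(maximalRealSubfield L)) L (IsCMField.complexConj L) 3 (Matrix.diagonal α) ⧸ Subgroup.centralizer ({γ} : Set (UnitaryGroup.arch (↥(maximalRealSubfield L)) L (IsCMField.complexConj L) 3 (Matrix.diagonal α))))]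
        (T' : ArchTransferFactor L (Matrix.diagonal α)) (μω : HeckeCharacter L) (_hμu : μω.IsUnitary)
        (_hμω : ∀ x : ideleGroup ↥(maximalRealSubfield L), μω (AdeleRing.ideleBaseChange (↥(maximalRealSubfield L)) L x) = quadraticHeckeCharCM L x)
        (c : ℂ) (_hc : c ≠ 0) (_hT' : ∀ a b, T'.Δ a b = c * archExplicitDelta L (Matrix.diagonal α) a μω b)
        (ν : Measure (UnitaryGroup.arch (↥(maximalRealSubfield L)) L (IsCMField.complexConj L) 3 (Matrix.diagonal α))) [ν.IsHaarMeasure] [ν.IsMulRightInvariant]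
        (e₁ e₂ : L) (h₁ : (IsCMField.complexConj L e₁ : L) * e₁ = 1) (h₂ : (IsCMField.complexConj L e₂ : L) * e₂ = 1) (_hne : e₁ ≠ e₂),
        GPrimeData L α T' ν e₁ e₂ h₁ h₂)
    (hTr : ∀ (α : Fin 3 → L) (P₀ : GL (Fin 3) L) (_hPα : formCongr (cmConjRingHom L) P₀ H' = Matrix.diagonal α)
        [MeasurableSpace (UnitaryGroup.arch (↥(maximalRealSubfield L)) L (IsCMField.complexConj L) 3 (Matrix.diagonal α))] [BorelSpace (UnitaryGroup.arch (↥(maximalRealSubfield L)) L (IsCMField.complexConj L) 3 (Matrix.diagonal α))]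
        [∀ γ : UnitaryGroup.arch (↥(maximalRealSubfield L)) L (IsCMField.complexConj L) 3 (Matrix.diagonal α), MeasurableSpace (UnitaryGroup.arch (↥(maximalRealSubfield L)) L (IsCMField.complexConj L) 3 (Matrix.diagonal α) ⧸ Subgroup.centralizer ({γ} : Set (UnitaryGroup.arch (↥(maximalRealSubfield L)) L (IsCMField.complexConj L) 3 (Matrix.diagonal α))))]
        [∀ γ : UnitaryGroup.arch (↥(maximalRealSubfield L)) L (IsCMField.complexConj L) 3 (Matrix.diagonal α), BorelSpace (UnitaryGroup.arch (↥(maximalRealSubfield L)) L (IsCMField.complexConj L) 3 (Matrix.diagonal α) ⧸ Subgroup.centralizer ({γ} : Set (UnitaryGroup.arch (↥(maximalRealSubfield L)) L (IsCMField.complexConj L) 3 (Matrix.diagonal α))))]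
        (Φ : UnitaryGroup.arch (↥(maximalRealSubfield L)) L (IsCMField.complexConj L) 3 (Matrix.diagonal α) ≃ₜ* UnitaryGroup.arch (↥(maximalRealSubfield L)) L (IsCMField.complexConj L) 3 H')
        (_hΦ : ∀ g, ((Φ g : UnitaryGroup.arch (↥(maximalRealSubfield L)) L (IsCMField.complexConj L) 3 H') : GL (Fin 3) (mixedEmbedding.mixedSpace L)) =
          Matrix.GeneralLinearGroup.map (mixedEmbedding L) P₀ * (g : GL (Fin 3) (mixedEmbedding.mixedSpace L)) * (Matrix.GeneralLinearGroup.map (mixedEmbedding L) P₀)⁻¹)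
        [νGi.IsHaarMeasure] (ν₂ : Measure (UnitaryGroup.arch (↥(maximalRealSubfield L)) L (IsCMField.complexConj L) 3 (Matrix.diagonal α))) [ν₂.IsHaarMeasure] [ν₂.IsMulRightInvariant] (_hν₂ : ν₂ = νGi.map Φ.symm)
        (a : UnitaryGroup.arch (↥(maximalRealSubfield L)) L (IsCMField.complexConj L) 3 H' → ℂ) (x : UnitaryGroup.arch (↥(maximalRealSubfield L)) L (IsCMField.complexConj L) 3 H') (y : UnitaryGroup.arch (↥(maximalRealSubfield L)) L (IsCMField.complexConj L) 3 (Matrix.diagonal α)),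
        IsStablyConj (UnitaryGroup.conjMixed (↥(maximalRealSubfield L)) L (IsCMField.complexConj L)) (UnitaryGroup.archFormOf L 3 (Matrix.diagonal α)) (Φ.symm x) y →
        (∀ x' : UnitaryGroup.arch (↥(maximalRealSubfield L)) L (IsCMField.complexConj L) 3 H', IsStablyConj (UnitaryGroup.conjMixed (↥(maximalRealSubfield L)) L (IsCMField.complexConj L)) (UnitaryGroup.archFormOf L 3 H') x x' →
          ∃ (a₀ b₀ : L) (T₀ : GL (Fin 3) (mixedEmbedding.mixedSpace L)) (Ha : Matrix (Fin 2) (Fin 2) L) (Hb : Matrix (Fin 1) (Fin 1) L),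
            Literature.NumberTheory.Weil1964.UnitaryArchTopForm.IsSingularArchFrame L H' x' a₀ b₀ T₀ Ha Hb) →
        archStableOrbitalIntegral L 3 H' (Literature.NumberTheory.Weil1964.UnitaryArchTopForm.archSingularTopFormFamily L H' νGi) a x =
          archStableOrbitalIntegral L 3 (Matrix.diagonal α) (Literature.NumberTheory.Weil1964.UnitaryArchTopForm.archSingularTopFormFamily L (Matrix.diagonal α) ν₂) (a ∘ Φ) y)
    (hanis : ∀ x : Fin 3 → L, hermForm (cmConjRingHom L) H' x x = 0 → x = 0)
    (m' : OrbitalMeasureFamily (UnitaryGroup.arch (↥(maximalRealSubfield L)) L (IsCMField.complexConj L) 3 H')) (m : OrbitalMeasureFamily (UnitaryGroup.arch (↥(maximalRealSubfield L)) L (IsCMField.complexConj L) 3 (Matrix.of fun i j : Fin 3 => if i.val + j.val + 1 = 3 then (1 : L) else 0)))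
    (mHi : OrbitalMeasureFamily (UnitaryGroup.arch (↥(maximalRealSubfield L)) L (IsCMField.complexConj L) 2 (Matrix.of fun i j : Fin 2 => if i.val + j.val + 1 = 2 then (1 : L) else 0) ×
          UnitaryGroup.arch (↥(maximalRealSubfield L)) L (IsCMField.complexConj L) 1 (Matrix.of fun i j : Fin 1 => if i.val + j.val + 1 = 1 then (1 : L) else 0)))
    (t' : ∀ γ' : UnitaryGroup.arch (↥(maximalRealSubfield L)) L (IsCMField.complexConj L) 3 H', Measure (Subgroup.centralizer ({γ'} : Set (UnitaryGroup.arch (↥(maximalRealSubfield L)) L (IsCMField.complexConj L) 3 H'))))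
    (t : ∀ γ : UnitaryGroup.arch (↥(maximalRealSubfield L)) L (IsCMField.complexConj L) 3 (Matrix.of fun i j : Fin 3 => if i.val + j.val + 1 = 3 then (1 : L) else 0),
      Measure (Subgroup.centralizer ({γ} : Set (UnitaryGroup.arch (↥(maximalRealSubfield L)) L (IsCMField.complexConj L) 3 (Matrix.of fun i j : Fin 3 => if i.val + j.val + 1 = 3 then (1 : L) else 0)))))
    (tH : ∀ γH : (UnitaryGroup.arch (↥(maximalRealSubfield L)) L (IsCMField.complexConj L) 2 (Matrix.of fun i j : Fin 2 => if i.val + j.val + 1 = 2 then (1 : L) else 0) ×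
          UnitaryGroup.arch (↥(maximalRealSubfield L)) L (IsCMField.complexConj L) 1 (Matrix.of fun i j : Fin 1 => if i.val + j.val + 1 = 1 then (1 : L) else 0)),
      Measure (Subgroup.centralizer ({γH} : Set (UnitaryGroup.arch (↥(maximalRealSubfield L)) L (IsCMField.complexConj L) 2 (Matrix.of fun i j : Fin 2 => if i.val + j.val + 1 = 2 then (1 : L) else 0) ×
          UnitaryGroup.arch (↥(maximalRealSubfield L)) L (IsCMField.complexConj L) 1 (Matrix.of fun i j : Fin 1 => if i.val + j.val + 1 = 1 then (1 : L) else 0)))))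
    (hherm : (H'.map (cmConjRingHom L)).transpose = H') (hACS : ArchCanonicalSingularMatrix L H' Tinf νGi νqi νHi hanis m' m mHi t' t tH)
    (μ : HeckeCharacter L) (hμu : μ.IsUnitary)
    (hμω : ∀ x : ideleGroup ↥(maximalRealSubfield L), μ (AdeleRing.ideleBaseChange (↥(maximalRealSubfield L)) L x) = quadraticHeckeCharCM L x)
    (hTinf : Tinf = archCanonicalTransferFactor L H' μ) :
              ∀ (γ₀ : (UnitaryGroup.cmDatum L 3 H').Rational) (e₁ e₂ : L), e₁ ≠ e₂ →
                ((((γ₀ : unitaryGroup (cmConjRingHom L) H').val : GL (Fin 3) L) : Matrix (Fin 3) (Fin 3) L) - e₁ • (1 : Matrix (Fin 3) (Fin 3) L)) * ((((γ₀ : unitaryGroup (cmConjRingHom L) H').val : GL (Fin 3) L) : Matrix (Fin 3) (Fin 3) L) - e₂ • (1 : Matrix (Fin 3) (Fin 3) L)) = 0 →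
                (¬ ∃ ζ : L, (((γ₀ : unitaryGroup (cmConjRingHom L) H').val : GL (Fin 3) L) : Matrix (Fin 3) (Fin 3) L) = ζ • (1 : Matrix (Fin 3) (Fin 3) L)) →
                (((γ₀ : unitaryGroup (cmConjRingHom L) H').val : GL (Fin 3) L) : Matrix (Fin 3) (Fin 3) L).charpoly =
                  (Polynomial.X - Polynomial.C e₁) ^ 2 * (Polynomial.X - Polynomial.C e₂) →
                ∀ (γH : (UnitaryGroup.cmDatum L 2 (Matrix.of fun i j : Fin 2 => if i.val + j.val + 1 = 2 then (1 : L) else 0)).Rational ×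
                    (UnitaryGroup.cmDatum L 1 (Matrix.of fun i j : Fin 1 => if i.val + j.val + 1 = 1 then (1 : L) else 0)).Rational),
                  (((γH.1 : unitaryGroup (cmConjRingHom L) (Matrix.of fun i j : Fin 2 => if i.val + j.val + 1 = 2 then (1 : L) else 0)).val : GL (Fin 2) L) : Matrix (Fin 2) (Fin 2) L) =
                    e₁ • (1 : Matrix (Fin 2) (Fin 2) L) →
                  (((γH.2 : unitaryGroup (cmConjRingHom L) (Matrix.of fun i j : Fin 1 => if i.val + j.val + 1 = 1 then (1 : L) else 0)).val : GL (Fin 1) L) : Matrix (Fin 1) (Fin 1) L) 0 0 = e₂ →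
                  ∃ cinf : ℂ, cinf ≠ 0 ∧
                    (∀ (aH : UnitaryGroup.arch (↥(maximalRealSubfield L)) L (IsCMField.complexConj L) 2 (Matrix.of fun i j : Fin 2 => if i.val + j.val + 1 = 2 then (1 : L) else 0) ×
                            UnitaryGroup.arch (↥(maximalRealSubfield L)) L (IsCMField.complexConj L) 1 (Matrix.of fun i j : Fin 1 => if i.val + j.val + 1 = 1 then (1 : L) else 0) → ℂ)
                          (a : UnitaryGroup.arch (↥(maximalRealSubfield L)) L (IsCMField.complexConj L) 3 H' → ℂ),
                        ArchSmooth L 3 H' a → ArchSmooth₂ L aH → IsArchDeltaTransfer L H' Tinf mHi m' aH a →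
                        archStableOrbitalIntegral L 3 H' (Literature.NumberTheory.Weil1964.UnitaryArchTopForm.archSingularTopFormFamily L H' νGi) a (cmRationalToArch L 3 H' γ₀) =
                          cinf * aH (cmRationalToArch L 2 (Matrix.of fun i j : Fin 2 => if i.val + j.val + 1 = 2 then (1 : L) else 0) γH.1, cmRationalToArch L 1 (Matrix.of fun i j : Fin 1 => if i.val + j.val + 1 = 1 then (1 : L) else 0) γH.2)) := by
  intro γ₀ e₁ e₂ hne hprod hnsc hchar γH hγ1 hγ2
  have hACS' := hACS
  obtain ⟨hadm', -, hadmH, -, -, hexist, hW', -, hWH, -, hC, hC'G, hCH, -, -⟩ := hACS'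
  have hd' : H'.det ≠ 0 := Godement.det_ne_zero_of_anisotropic L H' hanis
  have hd₃ : (Matrix.of fun i j : Fin 3 => if i.val + j.val + 1 = 3 then (1 : L) else 0).det ≠ 0 := (UnitaryGroup.isUnit_antidiagOne_det L 3).ne_zero
  -- `νGi` is a Haar measure ((i) + (W′) of `hACS`, ★ `isHaarMeasure_of_archCanonicalSingularMatrix`)
  haveI : νGi.IsHaarMeasure := isHaarMeasure_of_archCanonicalSingularMatrix L H' Tinf νGi νqi νHi hanis m' m mHi t' t tH hherm hACS
  -- the ray of the explicit factor: `Tinf.Δ = c(H′) · Δ″_∞`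
  have hT : ∀ a b, Tinf.Δ a b = ((archGlobalSign L H' : ℤ) : ℂ) * archExplicitDelta L H' a μ b := by
    intro a b
    rw [hTinf]
    exact archCanonicalTransferFactor_Δ L H' μ a b
  have hc₀ : ((archGlobalSign L H' : ℤ) : ℂ) ≠ 0 := archGlobalSign_cast_ne_zero L H'
  /- STEP 1: the rational diagonal frame of `H′` and its guards -/
  obtain ⟨P, α', hPα⟩ := exists_formCongr_eq_diagonal L H' hherm hanis
  have hherm' : ((Matrix.diagonal α').map (cmConjRingHom L))ᵀ = Matrix.diagonal α' := by
    have h := UnitaryGroup.transpose_map_formCongr_cm L P hherm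
    rwa [hPα] at h
  have hanis' : ∀ x : Fin 3 → L, hermForm (cmConjRingHom L) (Matrix.diagonal α') x x = 0 → x = 0 := by
    have h := UnitaryGroup.anisotropic_formCongr_cm L P hanis
    rwa [hPα] at h
  have hα' : ∀ i, α' i ≠ 0 := by
    have hdet := Godement.det_ne_zero_of_anisotropic L (Matrix.diagonal α') hanis'
    rw [Matrix.det_diagonal] at hdet
    exact fun i => (Finset.prod_ne_zero_iff.1 hdet) i (Finset.mem_univ i)
  have hαherm : ∀ i, (IsCMField.complexConj L (α' i) : L) = α' i := by
    intro i
    have h := congrFun (congrFun hherm' i) i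
    rw [Matrix.transpose_apply, Matrix.map_apply, Matrix.diagonal_apply_eq] at h
    exact h
  obtain ⟨Φ, hΦ, hΦΔ⟩ : ∃ Φ : UnitaryGroup.arch (↥(maximalRealSubfield L)) L (IsCMField.complexConj L) 3 (Matrix.diagonal α') ≃ₜ*
        UnitaryGroup.arch (↥(maximalRealSubfield L)) L (IsCMField.complexConj L) 3 H',
      (∀ g, ((Φ g : UnitaryGroup.arch (↥(maximalRealSubfield L)) L (IsCMField.complexConj L) 3 H') : GL (Fin 3) (mixedSpace L)) =
          Matrix.GeneralLinearGroup.map (mixedEmbedding L) P * (g : GL (Fin 3) (mixedSpace L)) * (Matrix.GeneralLinearGroup.map (mixedEmbedding L) P)⁻¹) ∧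
      ∀ (a : UnitaryGroup.arch (↥(maximalRealSubfield L)) L (IsCMField.complexConj L) 2 (Matrix.of fun i j : Fin 2 => if i.val + j.val + 1 = 2 then (1 : L) else 0) ×
          UnitaryGroup.arch (↥(maximalRealSubfield L)) L (IsCMField.complexConj L) 1 (Matrix.of fun i j : Fin 1 => if i.val + j.val + 1 = 1 then (1 : L) else 0)) g,
        archExplicitDelta L H' a μ (Φ g) = archExplicitDelta L (Matrix.diagonal α') a μ g :=
    ⟨_, UnitaryGroup.coe_archCongrOfEq_apply L hPα, fun a g => archExplicitDelta_archCongrOfEq L hPα a μ g⟩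
  have hΦsymm : ∀ g, ((Φ.symm g : UnitaryGroup.arch (↥(maximalRealSubfield L)) L (IsCMField.complexConj L) 3 (Matrix.diagonal α')) : GL (Fin 3) (mixedSpace L)) =
      (Matrix.GeneralLinearGroup.map (mixedEmbedding L) P)⁻¹ * (g : GL (Fin 3) (mixedSpace L)) * ((Matrix.GeneralLinearGroup.map (mixedEmbedding L) P)⁻¹)⁻¹ := by
    intro g
    have h := hΦ (Φ.symm g)
    rw [ContinuousMulEquiv.apply_symm_apply] at h
    rw [inv_inv, h]
    simp only [← mul_assoc, inv_mul_cancel, one_mul, inv_mul_cancel_right]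
  letI iD : MeasurableSpace (UnitaryGroup.arch (↥(maximalRealSubfield L)) L (IsCMField.complexConj L) 3 (Matrix.diagonal α')) := borel _
  haveI iDB : BorelSpace (UnitaryGroup.arch (↥(maximalRealSubfield L)) L (IsCMField.complexConj L) 3 (Matrix.diagonal α')) := ⟨rfl⟩
  letI iDQ : ∀ γ : UnitaryGroup.arch (↥(maximalRealSubfield L)) L (IsCMField.complexConj L) 3 (Matrix.diagonal α'),
      MeasurableSpace (UnitaryGroup.arch (↥(maximalRealSubfield L)) L (IsCMField.complexConj L) 3 (Matrix.diagonal α') ⧸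
        Subgroup.centralizer ({γ} : Set (UnitaryGroup.arch (↥(maximalRealSubfield L)) L (IsCMField.complexConj L) 3 (Matrix.diagonal α')))) := fun _ => borel _
  haveI iDQB : ∀ γ : UnitaryGroup.arch (↥(maximalRealSubfield L)) L (IsCMField.complexConj L) 3 (Matrix.diagonal α'),
      BorelSpace (UnitaryGroup.arch (↥(maximalRealSubfield L)) L (IsCMField.complexConj L) 3 (Matrix.diagonal α') ⧸
        Subgroup.centralizer ({γ} : Set (UnitaryGroup.arch (↥(maximalRealSubfield L)) L (IsCMField.complexConj L) 3 (Matrix.diagonal α')))) := fun _ => ⟨rfl⟩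
  haveI : (νGi.map Φ.symm).IsHaarMeasure := ContinuousMulEquiv.isHaarMeasure_map νGi Φ.symm
  haveI : (νGi.map Φ.symm).IsMulRightInvariant := isMulRightInvariant_map_mulEquiv_of_isMulRightInvariant Φ.symm.toMulEquiv Φ.symm.continuous.measurable νGi
  have hTΦ : ∀ a b, (Tinf.comap Φ.toMulEquiv (isArchNormPair_of_archCongr L _ Φ hΦ) : ArchTransferFactor L (Matrix.diagonal α')).Δ a b =
      ((archGlobalSign L H' : ℤ) : ℂ) * archExplicitDelta L (Matrix.diagonal α') a μ b := fun a b =>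
    calc (Tinf.comap Φ.toMulEquiv (isArchNormPair_of_archCongr L _ Φ hΦ) : ArchTransferFactor L (Matrix.diagonal α')).Δ a b = Tinf.Δ a (Φ b) := rfl
      _ = ((archGlobalSign L H' : ℤ) : ℂ) * archExplicitDelta L H' a μ (Φ b) := hT a (Φ b)
      _ = ((archGlobalSign L H' : ℤ) : ℂ) * archExplicitDelta L (Matrix.diagonal α') a μ b := by rw [hΦΔ]
  -- the wall torus point of `γ₀ ⊗ 1` on the diagonal carrier (★ (m2)), with `c(e_i) e_i = 1`
  obtain ⟨h₁, h₂, hwall⟩ := exists_isStablyConj_cmRationalToArch_archDiagTorus_wall L H' α' ((Matrix.GeneralLinearGroup.map (mixedEmbedding L) P)⁻¹) Φ.symm hΦsymm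
    hherm hanis γ₀ hne hprod hnsc hchar
  -- the two circles: centre `z_w = σ_w e₁`, frozen `U(Φ₁)`-angle `δ_w = σ_w e₂` (let-bound: definitionally the explicit subtypes)
  set zc : {w : InfinitePlace L // IsComplex w} → Circle :=
    fun w => ⟨w.1.embedding e₁, mem_sphere_zero_iff_norm.mpr (UnitaryGroup.norm_embedding_eq_one_of_complexConj_mul_self L e₁ h₁ w)⟩ with hzc
  set δc : {w : InfinitePlace L // IsComplex w} → Circle :=
    fun w => ⟨w.1.embedding e₂, mem_sphere_zero_iff_norm.mpr (UnitaryGroup.norm_embedding_eq_one_of_complexConj_mul_self L e₂ h₂ w)⟩ with hδc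
  have hzδ : ∀ w, zc w ≠ δc w := by
    intro w h
    have h' := congrArg (fun x : Circle => (x : ℂ)) h
    exact hne (w.1.embedding.injective h')
  -- the frozen `U(Φ₁)`-coordinate `δ = e₂ ⊗ 1`
  set δpt : UnitaryGroup.arch (↥(maximalRealSubfield L)) L (IsCMField.complexConj L) 1 (Matrix.of fun i j : Fin 1 => if i.val + j.val + 1 = 1 then (1 : L) else 0) :=
    (UnitaryGroup.archPiEquivCM 1 L (Matrix.of fun i j : Fin 1 => if i.val + j.val + 1 = 1 then (1 : L) else 0)).symm fun w =>
      ⟨UnitaryGroup.circleDiagonal 1 ![δc w], UnitaryGroup.circleDiagonal_mem_archLocal_antidiagOne L w _⟩ with hδpt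
  /- STEP 2: the 2-block frame `U(diag(½,−½))`, its Haar data, the endoscopic congruence `Ψ = Φ_{Q₂}` -/
  letI iw : ∀ w : {w : InfinitePlace L // IsComplex w}, MeasurableSpace (UnitaryGroup.archLocal L 2 (Matrix.diagonal ![(2 : L)⁻¹, -(2 : L)⁻¹]) w) := fun _ => borel _
  haveI iwB : ∀ w : {w : InfinitePlace L // IsComplex w}, BorelSpace (UnitaryGroup.archLocal L 2 (Matrix.diagonal ![(2 : L)⁻¹, -(2 : L)⁻¹]) w) := fun _ => ⟨rfl⟩
  haveI : ∀ w : {w : InfinitePlace L // IsComplex w}, LocallyCompactSpace (UnitaryGroup.archLocal L 2 (Matrix.diagonal ![(2 : L)⁻¹, -(2 : L)⁻¹]) w) :=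
    fun w => UnitaryGroup.locallyCompactSpace_archLocal L 2 _ w
  let νw : ∀ w : {w : InfinitePlace L // IsComplex w}, Measure (UnitaryGroup.archLocal L 2 (Matrix.diagonal ![(2 : L)⁻¹, -(2 : L)⁻¹]) w) := fun _ => Measure.haar
  haveI : ∀ w, (νw w).IsHaarMeasure := fun _ => inferInstance
  set Ψq : UnitaryGroup.arch (↥(maximalRealSubfield L)) L (IsCMField.complexConj L) 2 (Matrix.of fun i j : Fin 2 => if i.val + j.val + 1 = 2 then (1 : L) else 0) ≃ₜ*
      UnitaryGroup.arch (↥(maximalRealSubfield L)) L (IsCMField.complexConj L) 2 (Matrix.diagonal ![(2 : L)⁻¹, -(2 : L)⁻¹]) :=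
    unitaryGroupOfFormCongrOfEq (UnitaryGroup.conjMixed (↥(maximalRealSubfield L)) L (IsCMField.complexConj L))
      (Matrix.GeneralLinearGroup.map (mixedEmbedding L) (Matrix.GeneralLinearGroup.mkOfDetNeZero !![(1 : L), 1; 1, -1] (UnitaryGroup.det_quasiSplitFrameTwo_ne_zero L)))
      (UnitaryGroup.archFormOf L 2 (Matrix.diagonal ![(2 : L)⁻¹, -(2 : L)⁻¹])) (UnitaryGroup.archFormOf L 2 (Matrix.of fun i j : Fin 2 => if i.val + j.val + 1 = 2 then (1 : L) else 0))
      (UnitaryGroup.formCongr_map_mixedEmbedding_archFormOf_eq L (UnitaryGroup.formCongr_quasiSplitFrameTwo_diagonal L)) with hΨqdef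
  have hΨq : ∀ x, ((Ψq x : UnitaryGroup.arch (↥(maximalRealSubfield L)) L (IsCMField.complexConj L) 2 (Matrix.diagonal ![(2 : L)⁻¹, -(2 : L)⁻¹])) : GL (Fin 2) (mixedSpace L)) =
      Matrix.GeneralLinearGroup.map (mixedEmbedding L) (Matrix.GeneralLinearGroup.mkOfDetNeZero !![(1 : L), 1; 1, -1] (UnitaryGroup.det_quasiSplitFrameTwo_ne_zero L)) *
        (x : GL (Fin 2) (mixedSpace L)) * (Matrix.GeneralLinearGroup.map (mixedEmbedding L) (Matrix.GeneralLinearGroup.mkOfDetNeZero !![(1 : L), 1; 1, -1] (UnitaryGroup.det_quasiSplitFrameTwo_ne_zero L)))⁻¹ :=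
    fun x => UnitaryGroup.coe_archCongrOfEq_apply L (UnitaryGroup.formCongr_quasiSplitFrameTwo_diagonal L) x
  /- the speed-0 adapter (★ Engine): at a `G`-regular 2-block datum `u` the point `(Ψ⁻¹ t₂(u), δ)` is `G`-regular with compact partner centralisers -/
  have hpt : ∀ u : {w : InfinitePlace L // IsComplex w} → Fin 2 → Circle, (∀ w, u w 0 ≠ u w 1 ∧ u w 0 ≠ δc w ∧ u w 1 ≠ δc w) →
      IsArchGRegular L (Ψq.symm (UnitaryGroup.archDiagTorus L 2 ![(2 : L)⁻¹, -(2 : L)⁻¹] u), δpt) ∧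
      ∀ γ', IsArchNormPair L H' (Ψq.symm (UnitaryGroup.archDiagTorus L 2 ![(2 : L)⁻¹, -(2 : L)⁻¹] u), δpt) γ' →
        CompactSpace (Subgroup.centralizer ({γ'} : Set (UnitaryGroup.arch (↥(maximalRealSubfield L)) L (IsCMField.complexConj L) 3 H'))) :=
    fun u hu => twoBlockPoint_isArchGRegular_and_compactSpace L H' α' hα' hαherm P Φ hΦ e₂ h₂ u hu
  /- `νHi` is a Haar measure: (iii) + (W_H) of `hACS` at the `G`-regular class of the datum `(δ e^{i/2}, δ e^{−i/2})`, the reference Haar of the (unimodular) product -/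
  obtain ⟨u₁, hu₁⟩ : ∃ u₁ : {w : InfinitePlace L // IsComplex w} → Fin 2 → Circle, u₁ = fun w => ![δc w * Circle.exp (1 / 2 : ℝ), δc w * Circle.exp (-(1 / 2 : ℝ))] := ⟨_, rfl⟩
  have hu₁reg : ∀ w, u₁ w 0 ≠ u₁ w 1 ∧ u₁ w 0 ≠ δc w ∧ u₁ w 1 ≠ δc w := by
    intro w
    have h12 : (1 / 2 : ℝ) ∈ Ioo (-1 : ℝ) 1 := ⟨by norm_num, by norm_num⟩
    have h0 : (1 / 2 : ℝ) ≠ 0 := by norm_num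
    rw [hu₁]
    exact ⟨UnitaryGroup.mul_exp_ne_mul_exp_neg _ h12 h0, UnitaryGroup.mul_exp_ne_self _ h12 h0, UnitaryGroup.mul_exp_neg_ne_self _ h12 h0⟩
  haveI : νHi.IsHaarMeasure :=
    isHaarMeasure_H_of_isQuotientOf L νHi mHi tH hWH hadmH _ (hpt u₁ hu₁reg).1
  /- STEP 3: the constants — ★ (β₀)'s `κ`, the H-step constants `C_w` of `hH`, the G′-package's `λ` -/
  obtain ⟨κ, hκ, hβ₀⟩ := exists_sum_integral_pi_eq_inv_mul_finsum_delta L H' tH t' t (Godement.det_ne_zero_of_anisotropic L H' hanis) hd₃ hC hC'G hCH Tinf νGi νHi mHi m' hWH hW'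
    (![(2 : L)⁻¹, -(2 : L)⁻¹]) (UnitaryGroup.quasiSplitWeightsTwo_ne_zero (L := L)) (fun i => UnitaryGroup.cmConjRingHom_quasiSplitWeightsTwo L i)
    (UnitaryGroup.re_embedding_quasiSplitWeightsTwo_mul_neg L) νw
    (Matrix.GeneralLinearGroup.map (mixedEmbedding L) (Matrix.GeneralLinearGroup.mkOfDetNeZero !![(1 : L), 1; 1, -1] (UnitaryGroup.det_quasiSplitFrameTwo_ne_zero L)))
    Ψq hΨq zc Finset.univ rfl
  set C : {w : InfinitePlace L // IsComplex w} → ℝ := fun w₁ => (hH νw zc w₁).C with hCdef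
  have hC0 : ∀ w, C w ≠ 0 := fun w => (hH νw zc w).C_ne_zero
  have hCstep := fun w => (hH νw zc w).tendsto
  set 𝒢 := hG α' hα' hαherm (Tinf.comap Φ.toMulEquiv (isArchNormPair_of_archCongr L _ Φ hΦ)) μ hμu hμω _ hc₀ hTΦ (νGi.map Φ.symm) e₁ e₂ h₁ h₂ hne with h𝒢
  set lam : ℂ := 𝒢.lam with hlamdef
  have hlam : lam ≠ 0 := 𝒢.lam_ne_zero
  /- THE CONSTANT `cinf = κ · ∏_w C_w · 2^{|W|} ∕ λ` -/
  refine ⟨((κ * (∏ w, C w) * (Fintype.card ({w : InfinitePlace L // IsComplex w} → Bool) : ℝ) : ℝ) : ℂ) / lam, ?_, ?_⟩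
  · refine div_ne_zero ?_ hlam
    exact_mod_cast mul_ne_zero (mul_ne_zero hκ.ne' (Finset.prod_ne_zero_iff.2 fun w _ => hC0 w)) (Nat.cast_ne_zero.2 Fintype.card_ne_zero)
  intro aH a ha haH hδT
  have haHm : Measurable aH := haH.continuous.measurable
  have ham : Measurable a := ha.continuous.measurable
  have haΦ : ArchSmooth L 3 (Matrix.diagonal α') (a ∘ Φ) := ha.comp_archCongr L _ Φ hΦ
  -- ★ (3A′): the 2-block test function of `aH` with the `U(Φ₁)`-coordinate frozen at `δ`
  obtain ⟨Θ₂, hΘ, hΘc, hΘa⟩ := haH.exists_contDiff_twoBlock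
    (Matrix.GeneralLinearGroup.map (mixedEmbedding L) (Matrix.GeneralLinearGroup.mkOfDetNeZero !![(1 : L), 1; 1, -1] (UnitaryGroup.det_quasiSplitFrameTwo_ne_zero L))) Ψq hΨq δpt
  -- the centre `γ_H ⊗ 1` in the 2-block frame
  have hγ2' : (((γH.2 : unitaryGroup (cmConjRingHom L) (Matrix.of fun i j : Fin 1 => if i.val + j.val + 1 = 1 then (1 : L) else 0)).val : GL (Fin 1) L) :
      Matrix (Fin 1) (Fin 1) L) = e₂ • (1 : Matrix (Fin 1) (Fin 1) L) := by
    ext i j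
    fin_cases i; fin_cases j
    rw [Matrix.smul_apply, Matrix.one_apply_eq, smul_eq_mul, mul_one]
    exact hγ2
  have hcen₂ : cmRationalToArch L 1 (Matrix.of fun i j : Fin 1 => if i.val + j.val + 1 = 1 then (1 : L) else 0) γH.2 = δpt := by
    rw [cmRationalToArch_one_eq_symm_circleDiagonal_of_coe_eq_smul_one γH.2 hγ2', hδpt]
  have hcen₁ : Ψq (cmRationalToArch L 2 (Matrix.of fun i j : Fin 2 => if i.val + j.val + 1 = 2 then (1 : L) else 0) γH.1) =
      UnitaryGroup.archDiagTorus L 2 ![(2 : L)⁻¹, -(2 : L)⁻¹] (fun w _ => zc w) :=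
    congr_cmRationalToArch_two_eq_archDiagTorus_of_coe_eq_smul_one
      (Matrix.GeneralLinearGroup.map (mixedEmbedding L) (Matrix.GeneralLinearGroup.mkOfDetNeZero !![(1 : L), 1; 1, -1] (UnitaryGroup.det_quasiSplitFrameTwo_ne_zero L))) Ψq hΨq γH.1 hγ1
      (fun w => UnitaryGroup.norm_embedding_eq_one_of_complexConj_mul_self L e₁ h₁ w)
  have hval : aH (cmRationalToArch L 2 (Matrix.of fun i j : Fin 2 => if i.val + j.val + 1 = 2 then (1 : L) else 0) γH.1,
      cmRationalToArch L 1 (Matrix.of fun i j : Fin 1 => if i.val + j.val + 1 = 1 then (1 : L) else 0) γH.2) =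
      Θ₂ ((((UnitaryGroup.archPiEquivCM 2 L (Matrix.diagonal ![(2 : L)⁻¹, -(2 : L)⁻¹])).symm (fun w : {w : InfinitePlace L // IsComplex w} =>
        (⟨UnitaryGroup.circleDiagonal 2 ![zc w, zc w], UnitaryGroup.circleDiagonal_mem_archLocal_diagonal L 2 ![(2 : L)⁻¹, -(2 : L)⁻¹] w _⟩ :
          UnitaryGroup.archLocal L 2 (Matrix.diagonal ![(2 : L)⁻¹, -(2 : L)⁻¹]) w)) :
          UnitaryGroup.arch (↥(maximalRealSubfield L)) L (IsCMField.complexConj L) 2 (Matrix.diagonal ![(2 : L)⁻¹, -(2 : L)⁻¹])) : GL (Fin 2) (mixedSpace L)) : Matrix (Fin 2) (Fin 2) (mixedSpace L)) := by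
    rw [hΘa, hcen₂]
    congr 2
    apply Ψq.injective
    rw [ContinuousMulEquiv.apply_symm_apply, hcen₁, UnitaryGroup.archDiagTorus_eq_symm_apply]
    congr 1
    funext w
    apply Subtype.ext
    show UnitaryGroup.circleDiagonal 2 _ = UnitaryGroup.circleDiagonal 2 _
    congr 1
    funext i
    fin_cases i <;> rfl
  rw [hval]
  -- the G′-package's state family for `b = a ∘ Φ`
  set B := 𝒢.family (a ∘ Φ) haΦ with hBdef
  have hBreg := 𝒢.reg (a ∘ Φ) haΦ
  have hBstep := 𝒢.step (a ∘ Φ) haΦ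
  have hBend : ∀ u : {w : InfinitePlace L // IsComplex w} → Fin 2 → Circle, B Finset.univ u = lam *
      archStableOrbitalIntegral L 3 (Matrix.diagonal α') (Literature.NumberTheory.Weil1964.UnitaryArchTopForm.archSingularTopFormFamily L (Matrix.diagonal α') (νGi.map Φ.symm)) (a ∘ Φ)
        (UnitaryGroup.archDiagTorus L 3 α' fun w => ![zc w, δc w, zc w]) := fun u => 𝒢.end_eq (a ∘ Φ) haΦ u
  -- the H-side symmetrised mixed orbital integral of `Θ₂` (★ (E2)'s `Σ_ε ∫ Θ₂ d⊗M(T, u, ε)`) and the H-STATE family `A(S, u) = κ ∏_{w ∈ S} C_w · I(univ ∖ S, u)`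
  obtain ⟨I, hI⟩ : ∃ I : Finset {w : InfinitePlace L // IsComplex w} → ({w : InfinitePlace L // IsComplex w} → Fin 2 → Circle) → ℂ, I = fun T u =>
      ∑ ε : {w : InfinitePlace L // IsComplex w} → Bool,
        ∫ o, Θ₂ (((((UnitaryGroup.archPiEquivCM 2 L (Matrix.diagonal ![(2 : L)⁻¹, -(2 : L)⁻¹])).symm o) :
            UnitaryGroup.arch (↥(maximalRealSubfield L)) L (IsCMField.complexConj L) 2 (Matrix.diagonal ![(2 : L)⁻¹, -(2 : L)⁻¹])) : GL (Fin 2) (mixedSpace L)) :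
            Matrix (Fin 2) (Fin 2) (mixedSpace L))
          ∂(Measure.pi (fun w : {w : InfinitePlace L // IsComplex w} =>
            if w ∈ T then (νw w).map (fun g : UnitaryGroup.archLocal L 2 (Matrix.diagonal ![(2 : L)⁻¹, -(2 : L)⁻¹]) w =>
              g * ⟨UnitaryGroup.circleDiagonal 2 (if ε w then u w ∘ ⇑(Equiv.swap (0 : Fin 2) 1) else u w),
                UnitaryGroup.circleDiagonal_mem_archLocal_diagonal L 2 ![(2 : L)⁻¹, -(2 : L)⁻¹] w _⟩ * g⁻¹)
            else Measure.dirac (⟨UnitaryGroup.circleDiagonal 2 ![zc w, zc w], UnitaryGroup.circleDiagonal_mem_archLocal_diagonal L 2 ![(2 : L)⁻¹, -(2 : L)⁻¹] w _⟩ :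
              UnitaryGroup.archLocal L 2 (Matrix.diagonal ![(2 : L)⁻¹, -(2 : L)⁻¹]) w))) := ⟨_, rfl⟩
  obtain ⟨A, hA⟩ : ∃ A : Finset {w : InfinitePlace L // IsComplex w} → ({w : InfinitePlace L // IsComplex w} → Fin 2 → Circle) → ℂ,
      A = fun S u => ((κ * ∏ w ∈ S, C w : ℝ) : ℂ) * I (Finset.univ \ S) u := ⟨_, rfl⟩
  /- the H-STEP LAW for `A` (from `hH`) -/
  have hAstep : ∀ (S : Finset {w : InfinitePlace L // IsComplex w}) (w : {w : InfinitePlace L // IsComplex w}), w ∉ S →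
      ∀ u : {w : InfinitePlace L // IsComplex w} → Fin 2 → Circle, (∀ v, v ∉ S → v ≠ w → u v 0 ≠ u v 1 ∧ u v 0 ≠ δc v ∧ u v 1 ≠ δc v) →
      Tendsto (fun ψ : ℝ => deriv (fun ψ : ℝ => (2 * Real.sin ψ) • A S (Function.update u w ![zc w * Circle.exp ψ, zc w * Circle.exp (-ψ)])) ψ)
        (𝓝[>] 0) (𝓝 (A (insert w S) u)) := by
    intro S w hw u hu
    have hwT : w ∈ Finset.univ \ S := Finset.mem_sdiff.2 ⟨Finset.mem_univ w, hw⟩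
    have hu' : ∀ v ∈ Finset.univ \ S, v ≠ w → u v 0 ≠ u v 1 := fun v hv hvw => (hu v (Finset.mem_sdiff.1 hv).2 hvw).1
    have h1 := (hCstep w Θ₂ hΘ hΘc (Finset.univ \ S) hwT u hu').mono_left (nhdsWithin_mono (0 : ℝ) (show Set.Ioi (0 : ℝ) ⊆ {0}ᶜ from fun x hx => ne_of_gt hx))
    have h3 := h1.const_mul ((κ * ∏ v ∈ S, C v : ℝ) : ℂ)
    rw [hA]
    simp only [hI, deriv_two_sin_smul_const_mul]
    rw [Finset.sdiff_insert]
    convert h3 using 2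
    rw [Complex.real_smul, ← mul_assoc]
    congr 1
    push_cast
    rw [Finset.prod_insert hw]
    ring
  /- the torus identity at `S = ∅` (★ (β₀) at every `G`-regular datum, ★ (α) on its right side, (reg) of `hG`) -/
  have hregA : ∀ u : {w : InfinitePlace L // IsComplex w} → Fin 2 → Circle, (∀ v, u v 0 ≠ u v 1 ∧ u v 0 ≠ δc v ∧ u v 1 ≠ δc v) → A ∅ u = B ∅ u := by
    intro u hu
    obtain ⟨hGreg, hZ'⟩ := hpt u hu
    have hβ := hβ₀ aH a haHm ham hδT u (fun w => (hu w).1) δpt hGreg hZ'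
    rw [finsum_delta_mul_integral_comp_conj_eq_comap L (Matrix.GeneralLinearGroup.map (mixedEmbedding L) P) Φ hΦ Tinf νGi a _] at hβ
    have hB0 : B ∅ u = ∑ᶠ c'' : ConjClasses (UnitaryGroup.arch (↥(maximalRealSubfield L)) L (IsCMField.complexConj L) 3 (Matrix.diagonal α')),
        (Tinf.comap Φ.toMulEquiv (isArchNormPair_of_archCongr L _ Φ hΦ) : ArchTransferFactor L (Matrix.diagonal α')).Δ
            (Ψq.symm (UnitaryGroup.archDiagTorus L 2 ![(2 : L)⁻¹, -(2 : L)⁻¹] u), δpt) (Quotient.out c'') *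
          ∫ g, (a ∘ Φ) (g * Quotient.out c'' * g⁻¹) ∂(νGi.map Φ.symm) := hBreg u hu
    rw [← hB0] at hβ
    rw [hA]
    simp only [hI, hΘa, Finset.prod_empty, mul_one, Finset.sdiff_empty]
    rw [hβ, ← mul_assoc, ← Complex.ofReal_mul, mul_inv_cancel₀ hκ.ne', Complex.ofReal_one, one_mul]
  /- the JOINT INDUCTION -/
  have hmain := joint_induction (Z := fun _ : {w : InfinitePlace L // IsComplex w} => Fin 2 → Circle) (F := ℂ)
    (fun v uv => uv 0 ≠ uv 1 ∧ uv 0 ≠ δc v ∧ uv 1 ≠ δc v) A B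
    (fun w ψ => ![zc w * Circle.exp ψ, zc w * Circle.exp (-ψ)]) (fun ψ x => (2 * Real.sin ψ) • x) (𝓝[>] (0 : ℝ))
    (fun w => eventually_nhdsGT_regular_centralCurve (zc w) (δc w) (hzδ w)) hregA hAstep
    (fun S w hw u hu => hBstep S w hw u hu)
  /- STEP 4: read both end states and transport -/
  have hfin := hmain u₁
  rw [hA] at hfin
  simp only [hI] at hfin
  rw [Finset.sdiff_self, UnitaryGroup.sum_integral_pi_empty_eq_card_smul_apply_center L ![(2 : L)⁻¹, -(2 : L)⁻¹] νw zc Θ₂ u₁, hBend u₁] at hfin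
  -- transport of the unsigned top-form stable sum along `Φ` and along `Φ⁻¹(γ₀ ⊗ 1) ∼_st t(e₁,e₂,e₁)`
  have hT1 : archStableOrbitalIntegral L 3 H' (Literature.NumberTheory.Weil1964.UnitaryArchTopForm.archSingularTopFormFamily L H' νGi) a (cmRationalToArch L 3 H' γ₀) =
      archStableOrbitalIntegral L 3 (Matrix.diagonal α') (Literature.NumberTheory.Weil1964.UnitaryArchTopForm.archSingularTopFormFamily L (Matrix.diagonal α') (νGi.map Φ.symm)) (a ∘ Φ)
        (UnitaryGroup.archDiagTorus L 3 α' fun w => ![zc w, δc w, zc w]) :=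
    hTr α' P hPα Φ hΦ (νGi.map Φ.symm) rfl a _ _ hwall fun x' hx' =>
      exists_isSingularArchFrame_of_isStablyConj_cmRationalToArch L H' hherm hanis γ₀
        (not_isRegularElt_of_charpoly_eq_sq_mul _ e₁ e₂ hchar) (fun ζ h => hnsc ⟨ζ, h⟩) hx'
  rw [hT1]
  -- `κ ∏C · card • Θ₂(centre) = λ · SO^{diag}` ⇒ `SO^{diag} = cinf · Θ₂(centre)`
  rw [Complex.real_smul] at hfin
  push_cast at hfin ⊢
  rw [div_mul_eq_mul_div, eq_div_iff hlam]
  linear_combination (-1 : ℂ) * hfin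

end Frame

end Summit.HodgeConjecture.HodgeConjecture.Cruxes.H413.K2E4ExplicitArchSingularTransferOfPackages

end
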